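import Summits.CriticalPhenomena.PercolationContinuityZ3.Theorems.PercNearOneGluingNoHeavyLowerTailAntitheticBoundaryCount
import HarnessLib

/-!
# `NoHeavyLowerTail` (stmt-CriticalPhenomena-4575) — antithetic cluster pairs: THEOREM OS (one-sided augmentation on a cycle, any number of markers),
# the abstract BOUNDARY COUNT (prim-hp-2 gen 44; HOME/THEOREM-OS-augmentation.md §2)

Support file (`--supports stmt-CriticalPhenomena-4575`, hull-port prover `prim-hp-2`, gen 44).  No definitions, no named facts, no sorries; standard axioms.

PURE COMBINATORICS.  THEOREM OS: for the cycle `v 0 = s, …, v (n−1)`, blue markers at any vertices `≠ s` and the lift `ℓY = Y ∪ (markers at vertices seen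
by Y)`, `Σ_{T ∈ D(R′)} (F(C) − F(ℓC′))(G(C) − G(ℓC′)) ≥ 0`.  Its boundary layer consists of the plain arcs `(A_k, ∅)`, the lifted arcs `(∅, ℓA_k)`, the
full terms `(E, ∅)`, `(∅, ℓE)` and, at every position `i` allowed by `R′`, the PAIR of one-change terms `rb_i = (P_i, ℓQ_{n−i})`, `br_i = (Q_{n−i}, ℓP_i)`.
For upper sets `U, W` with thresholds `a, c` (plain chains `P, Q` in `U`), `a⁺ ≤ a, c⁺ ≤ c` (lifted chains), `b, d, b⁺, d⁺` (for `W`), the indicator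
patterns are `rb_i : (a ≤ i, c⁺ ≤ n−i, b ≤ i, d⁺ ≤ n−i)`, `br_i : (c ≤ n−i, a⁺ ≤ i, d ≤ n−i, b⁺ ≤ i)`; BAD = `(1,0,0,1), (0,1,1,0)`, GOOD =
`(1,0,1,0), (0,1,0,1)`.
* `Antithetic.OSCount.count` — for EVERY set `I` of positions: #bad one-change terms on `I` ≤ #good one-change terms on `I` + #forced good plain arcs
  (`BCount.arcGood n a c b d` + `fullGood`) + #forced good lifted arcs (`BCount.arcGood n a⁺ c⁺ b⁺ d⁺` + `fullGood`).  The ONLY hypotheses are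
  `a⁺ ≤ a, c⁺ ≤ c, b⁺ ≤ b, d⁺ ≤ d` (and thresholds `≥ 1`).  Proof: exclusivity of the two bad types per orientation, CROSS-CANCELLATION
  (`cross_cancel`: if `rb` has a type-1 bad position and `br` a type-1′ bad position then both positions carry a good term of the other orientation), and
  the convexity count `#rb1 + #br2′ ≤ len[a, n−d⁺] + len[a⁺, n−d] ≤ len[a, n−d] + len[a⁺, n−d⁺] ≤ goods` (`BCount.len_le_good`).
Machine-checked exhaustively before formalisation: HOME/code/gen44/lab/absos2e.py (n ≤ 7, 0 failures).
[cite: VandenbergHaggstromKahn2005, §1 p. 3 (open cluster `C_s`)]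
-/

namespace Summit.CriticalPhenomena.PercolationContinuityZ3.Theorems

open scoped Classical

namespace Antithetic

namespace OSCount

variable {n : ℕ} {I : Finset ℕ} {a c ap cp b d bp dp : ℕ}

/-- Type-1 bad `rb` positions `a ≤ i < b`, `d⁺ ≤ n−i < c⁺` lie in `[a, n − d⁺]`; type-2′ bad `br` positions in `[a⁺, n − d]`; convexity and
`BCount.len_le_good` bound their number by the forced good arcs. [this work] -/
theorem cross_le (ha : 1 ≤ a) (hap1 : 1 ≤ ap) (hd : 1 ≤ d) (hdp1 : 1 ≤ dp) (hap : ap ≤ a) (hdp : dp ≤ d) :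
    (I.filter fun i => a ≤ i ∧ ¬ cp ≤ n - i ∧ ¬ b ≤ i ∧ dp ≤ n - i).card +
        (I.filter fun i => ¬ c ≤ n - i ∧ ap ≤ i ∧ d ≤ n - i ∧ ¬ bp ≤ i).card ≤
      (BCount.arcGood n a c b d).card + BCount.fullGood n a c b d + ((BCount.arcGood n ap cp bp dp).card + BCount.fullGood n ap cp bp dp) := by
  have h1 : (I.filter fun i => a ≤ i ∧ ¬ cp ≤ n - i ∧ ¬ b ≤ i ∧ dp ≤ n - i) ⊆ Finset.Icc a (n - dp) := by
    intro i hi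
    rw [Finset.mem_filter] at hi
    rw [Finset.mem_Icc]
    omega
  have h2 : (I.filter fun i => ¬ c ≤ n - i ∧ ap ≤ i ∧ d ≤ n - i ∧ ¬ bp ≤ i) ⊆ Finset.Icc ap (n - d) := by
    intro i hi
    rw [Finset.mem_filter] at hi
    rw [Finset.mem_Icc]
    omega
  have c1 := Finset.card_le_card h1
  have c2 := Finset.card_le_card h2
  rw [Nat.card_Icc] at c1 c2
  have g1 := BCount.len_le_good (n := n) (c := c) (b := b) ha hd
  have g2 := BCount.len_le_good (n := n) (c := cp) (b := bp) hap1 hdp1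
  omega

/-- **Cross-cancellation.**  A type-1 bad `rb` position `i` and a type-1′ bad `br` position `k` force `br_i` and `rb_k` to be GOOD. [this work] -/
theorem cross_cancel (hap : ap ≤ a) (hcp : cp ≤ c) {i k : ℕ} (hi : a ≤ i ∧ ¬ cp ≤ n - i ∧ ¬ b ≤ i ∧ dp ≤ n - i)
    (hk : c ≤ n - k ∧ ¬ ap ≤ k ∧ ¬ d ≤ n - k ∧ bp ≤ k) :
    (¬ c ≤ n - i ∧ ap ≤ i ∧ ¬ d ≤ n - i ∧ bp ≤ i) ∧ (¬ a ≤ k ∧ cp ≤ n - k ∧ ¬ b ≤ k ∧ dp ≤ n - k) := by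
  omega

/-- Reordering of a bad/good pattern under the exchange `U ↔ W`. [folklore] -/
theorem pattern_swap (x x' y y' : Prop) :
    ((y ∧ ¬ y' ∧ ¬ x ∧ x') ∨ (¬ y ∧ y' ∧ x ∧ ¬ x')) ↔ ((x ∧ ¬ x' ∧ ¬ y ∧ y') ∨ (¬ x ∧ x' ∧ y ∧ ¬ y')) := by
  constructor
  · rintro (⟨h1, h2, h3, h4⟩ | ⟨h1, h2, h3, h4⟩)
    · exact Or.inr ⟨h3, h4, h1, h2⟩
    · exact Or.inl ⟨h3, h4, h1, h2⟩
  · rintro (⟨h1, h2, h3, h4⟩ | ⟨h1, h2, h3, h4⟩)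
    · exact Or.inr ⟨h3, h4, h1, h2⟩
    · exact Or.inl ⟨h3, h4, h1, h2⟩

/-- Reordering of a good pattern under `U ↔ W`. [folklore] -/
theorem pattern_swap' (x x' y y' : Prop) :
    ((y ∧ ¬ y' ∧ x ∧ ¬ x') ∨ (¬ y ∧ y' ∧ ¬ x ∧ x')) ↔ ((x ∧ ¬ x' ∧ y ∧ ¬ y') ∨ (¬ x ∧ x' ∧ ¬ y ∧ y')) := by
  constructor
  · rintro (⟨h1, h2, h3, h4⟩ | ⟨h1, h2, h3, h4⟩)
    · exact Or.inl ⟨h3, h4, h1, h2⟩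
    · exact Or.inr ⟨h3, h4, h1, h2⟩
  · rintro (⟨h1, h2, h3, h4⟩ | ⟨h1, h2, h3, h4⟩)
    · exact Or.inl ⟨h3, h4, h1, h2⟩
    · exact Or.inr ⟨h3, h4, h1, h2⟩

/-- One-sided version of the count: if no type-2 `rb` and no type-1′ `br` bad position is present … (used twice, with `U ↔ W`). -/
private theorem count_aux (ha : 1 ≤ a) (hap1 : 1 ≤ ap) (hd : 1 ≤ d) (hdp1 : 1 ≤ dp) (hap : ap ≤ a) (hcp : cp ≤ c) (hdp : dp ≤ d)
    (h1 : (I.filter fun i => a ≤ i ∧ ¬ cp ≤ n - i ∧ ¬ b ≤ i ∧ dp ≤ n - i).Nonempty) :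
    (I.filter fun i => (a ≤ i ∧ ¬ cp ≤ n - i ∧ ¬ b ≤ i ∧ dp ≤ n - i) ∨ (¬ a ≤ i ∧ cp ≤ n - i ∧ b ≤ i ∧ ¬ dp ≤ n - i)).card +
        (I.filter fun i => (c ≤ n - i ∧ ¬ ap ≤ i ∧ ¬ d ≤ n - i ∧ bp ≤ i) ∨ (¬ c ≤ n - i ∧ ap ≤ i ∧ d ≤ n - i ∧ ¬ bp ≤ i)).card ≤
      (I.filter fun i => (a ≤ i ∧ ¬ cp ≤ n - i ∧ b ≤ i ∧ ¬ dp ≤ n - i) ∨ (¬ a ≤ i ∧ cp ≤ n - i ∧ ¬ b ≤ i ∧ dp ≤ n - i)).card +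
        (I.filter fun i => (c ≤ n - i ∧ ¬ ap ≤ i ∧ d ≤ n - i ∧ ¬ bp ≤ i) ∨ (¬ c ≤ n - i ∧ ap ≤ i ∧ ¬ d ≤ n - i ∧ bp ≤ i)).card +
        ((BCount.arcGood n a c b d).card + BCount.fullGood n a c b d + ((BCount.arcGood n ap cp bp dp).card + BCount.fullGood n ap cp bp dp)) := by
  obtain ⟨i₀, hi₀⟩ := h1
  rw [Finset.mem_filter] at hi₀
  -- no type-2 rb position (needs `b < a`, but `a ≤ i₀ < b`)
  have erb : (I.filter fun i => (a ≤ i ∧ ¬ cp ≤ n - i ∧ ¬ b ≤ i ∧ dp ≤ n - i) ∨ (¬ a ≤ i ∧ cp ≤ n - i ∧ b ≤ i ∧ ¬ dp ≤ n - i)) =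
      I.filter fun i => a ≤ i ∧ ¬ cp ≤ n - i ∧ ¬ b ≤ i ∧ dp ≤ n - i := by
    refine Finset.filter_congr fun i _ => ⟨fun h => h.elim id fun h => by omega, Or.inl⟩
  rw [erb]
  by_cases h1' : (I.filter fun i => c ≤ n - i ∧ ¬ ap ≤ i ∧ ¬ d ≤ n - i ∧ bp ≤ i).Nonempty
  · -- cross-cancellation: everything is cancelled
    obtain ⟨k₀, hk₀⟩ := h1'
    rw [Finset.mem_filter] at hk₀
    have ebr : (I.filter fun i => (c ≤ n - i ∧ ¬ ap ≤ i ∧ ¬ d ≤ n - i ∧ bp ≤ i) ∨ (¬ c ≤ n - i ∧ ap ≤ i ∧ d ≤ n - i ∧ ¬ bp ≤ i)) =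
        I.filter fun i => c ≤ n - i ∧ ¬ ap ≤ i ∧ ¬ d ≤ n - i ∧ bp ≤ i := by
      refine Finset.filter_congr fun i _ => ⟨fun h => h.elim id fun h => by omega, Or.inl⟩
    rw [ebr]
    have s1 : (I.filter fun i => a ≤ i ∧ ¬ cp ≤ n - i ∧ ¬ b ≤ i ∧ dp ≤ n - i) ⊆
        I.filter fun i => (c ≤ n - i ∧ ¬ ap ≤ i ∧ d ≤ n - i ∧ ¬ bp ≤ i) ∨ (¬ c ≤ n - i ∧ ap ≤ i ∧ ¬ d ≤ n - i ∧ bp ≤ i) := by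
      intro i hi
      rw [Finset.mem_filter] at hi ⊢
      exact ⟨hi.1, Or.inr (cross_cancel hap hcp hi.2 hk₀.2).1⟩
    have s2 : (I.filter fun i => c ≤ n - i ∧ ¬ ap ≤ i ∧ ¬ d ≤ n - i ∧ bp ≤ i) ⊆
        I.filter fun i => (a ≤ i ∧ ¬ cp ≤ n - i ∧ b ≤ i ∧ ¬ dp ≤ n - i) ∨ (¬ a ≤ i ∧ cp ≤ n - i ∧ ¬ b ≤ i ∧ dp ≤ n - i) := by
      intro k hk
      rw [Finset.mem_filter] at hk ⊢
      exact ⟨hk.1, Or.inr (cross_cancel hap hcp hi₀.2 hk.2).2⟩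
    have c1 := Finset.card_le_card s1
    have c2 := Finset.card_le_card s2
    omega
  · -- no type-1′ br position: the bads are rb1 ∪ br2′, paid by the arcs
    have ebr : (I.filter fun i => (c ≤ n - i ∧ ¬ ap ≤ i ∧ ¬ d ≤ n - i ∧ bp ≤ i) ∨ (¬ c ≤ n - i ∧ ap ≤ i ∧ d ≤ n - i ∧ ¬ bp ≤ i)) =
        I.filter fun i => ¬ c ≤ n - i ∧ ap ≤ i ∧ d ≤ n - i ∧ ¬ bp ≤ i := by
      refine Finset.filter_congr fun i hiI => ⟨fun h => h.elim (fun h => ?_) id, Or.inr⟩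
      exact absurd ⟨i, Finset.mem_filter.2 ⟨hiI, h⟩⟩ h1'
    rw [ebr]
    have := cross_le (n := n) (I := I) (c := c) (cp := cp) (b := b) (bp := bp) ha hap1 hd hdp1 hap hdp
    exact this.trans (Nat.le_add_left _ _)

/-- **THE BOUNDARY COUNT OF THEOREM OS** (any number of markers): on every set `I` of positions, #bad one-change terms ≤ #good one-change terms +
#forced good arcs and full terms (plain and lifted). [this work] -/
theorem count (I : Finset ℕ)
    (ha : 1 ≤ a) (hc : 1 ≤ c) (hap1 : 1 ≤ ap) (hcp1 : 1 ≤ cp) (hb : 1 ≤ b) (hd : 1 ≤ d) (hbp1 : 1 ≤ bp) (hdp1 : 1 ≤ dp)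
    (hap : ap ≤ a) (hcp : cp ≤ c) (hbp : bp ≤ b) (hdp : dp ≤ d) :
    (I.filter fun i => (a ≤ i ∧ ¬ cp ≤ n - i ∧ ¬ b ≤ i ∧ dp ≤ n - i) ∨ (¬ a ≤ i ∧ cp ≤ n - i ∧ b ≤ i ∧ ¬ dp ≤ n - i)).card +
        (I.filter fun i => (c ≤ n - i ∧ ¬ ap ≤ i ∧ ¬ d ≤ n - i ∧ bp ≤ i) ∨ (¬ c ≤ n - i ∧ ap ≤ i ∧ d ≤ n - i ∧ ¬ bp ≤ i)).card ≤
      (I.filter fun i => (a ≤ i ∧ ¬ cp ≤ n - i ∧ b ≤ i ∧ ¬ dp ≤ n - i) ∨ (¬ a ≤ i ∧ cp ≤ n - i ∧ ¬ b ≤ i ∧ dp ≤ n - i)).card +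
        (I.filter fun i => (c ≤ n - i ∧ ¬ ap ≤ i ∧ d ≤ n - i ∧ ¬ bp ≤ i) ∨ (¬ c ≤ n - i ∧ ap ≤ i ∧ ¬ d ≤ n - i ∧ bp ≤ i)).card +
        ((BCount.arcGood n a c b d).card + BCount.fullGood n a c b d + ((BCount.arcGood n ap cp bp dp).card + BCount.fullGood n ap cp bp dp)) := by
  by_cases h1 : (I.filter fun i => a ≤ i ∧ ¬ cp ≤ n - i ∧ ¬ b ≤ i ∧ dp ≤ n - i).Nonempty
  · exact count_aux (bp := bp) ha hap1 hd hdp1 hap hcp hdp h1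
  by_cases h2 : (I.filter fun i => b ≤ i ∧ ¬ dp ≤ n - i ∧ ¬ a ≤ i ∧ cp ≤ n - i).Nonempty
  · -- the `U ↔ W` mirror image: type 2 for (U, W) is type 1 for (W, U)
    have key := count_aux (n := n) (I := I) (a := b) (c := d) (ap := bp) (cp := dp) (b := a) (d := c) (bp := ap) (dp := cp)
      hb hbp1 hc hcp1 hbp hdp hcp h2
    have e1 : (I.filter fun i => (b ≤ i ∧ ¬ dp ≤ n - i ∧ ¬ a ≤ i ∧ cp ≤ n - i) ∨ (¬ b ≤ i ∧ dp ≤ n - i ∧ a ≤ i ∧ ¬ cp ≤ n - i)) =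
        I.filter fun i => (a ≤ i ∧ ¬ cp ≤ n - i ∧ ¬ b ≤ i ∧ dp ≤ n - i) ∨ (¬ a ≤ i ∧ cp ≤ n - i ∧ b ≤ i ∧ ¬ dp ≤ n - i) :=
      Finset.filter_congr fun i _ => pattern_swap _ _ _ _
    have e2 : (I.filter fun i => (d ≤ n - i ∧ ¬ bp ≤ i ∧ ¬ c ≤ n - i ∧ ap ≤ i) ∨ (¬ d ≤ n - i ∧ bp ≤ i ∧ c ≤ n - i ∧ ¬ ap ≤ i)) =
        I.filter fun i => (c ≤ n - i ∧ ¬ ap ≤ i ∧ ¬ d ≤ n - i ∧ bp ≤ i) ∨ (¬ c ≤ n - i ∧ ap ≤ i ∧ d ≤ n - i ∧ ¬ bp ≤ i) :=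
      Finset.filter_congr fun i _ => pattern_swap _ _ _ _
    have e3 : (I.filter fun i => (b ≤ i ∧ ¬ dp ≤ n - i ∧ a ≤ i ∧ ¬ cp ≤ n - i) ∨ (¬ b ≤ i ∧ dp ≤ n - i ∧ ¬ a ≤ i ∧ cp ≤ n - i)) =
        I.filter fun i => (a ≤ i ∧ ¬ cp ≤ n - i ∧ b ≤ i ∧ ¬ dp ≤ n - i) ∨ (¬ a ≤ i ∧ cp ≤ n - i ∧ ¬ b ≤ i ∧ dp ≤ n - i) :=
      Finset.filter_congr fun i _ => pattern_swap' _ _ _ _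
    have e4 : (I.filter fun i => (d ≤ n - i ∧ ¬ bp ≤ i ∧ c ≤ n - i ∧ ¬ ap ≤ i) ∨ (¬ d ≤ n - i ∧ bp ≤ i ∧ ¬ c ≤ n - i ∧ ap ≤ i)) =
        I.filter fun i => (c ≤ n - i ∧ ¬ ap ≤ i ∧ d ≤ n - i ∧ ¬ bp ≤ i) ∨ (¬ c ≤ n - i ∧ ap ≤ i ∧ ¬ d ≤ n - i ∧ bp ≤ i) :=
      Finset.filter_congr fun i _ => pattern_swap' _ _ _ _
    rw [e1, e2, e3, e4, BCount.arcGood_swap (a := b), BCount.fullGood_swap (a := b), BCount.arcGood_swap (a := bp), BCount.fullGood_swap (a := bp)]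
      at key
    exact key
  -- neither type-1 nor type-2 rb positions: all bad terms are of br type, one family only
  have erb : (I.filter fun i => (a ≤ i ∧ ¬ cp ≤ n - i ∧ ¬ b ≤ i ∧ dp ≤ n - i) ∨ (¬ a ≤ i ∧ cp ≤ n - i ∧ b ≤ i ∧ ¬ dp ≤ n - i)) = ∅ := by
    refine Finset.filter_eq_empty_iff.2 fun i hiI h => h.elim (fun h => h1 ⟨i, Finset.mem_filter.2 ⟨hiI, h⟩⟩) fun h => h2 ⟨i, ?_⟩
    rw [Finset.mem_filter]
    exact ⟨hiI, h.2.2.1, h.2.2.2, h.1, h.2.1⟩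
  rw [erb, Finset.card_empty, zero_add]
  by_cases h3 : (I.filter fun i => c ≤ n - i ∧ ¬ ap ≤ i ∧ ¬ d ≤ n - i ∧ bp ≤ i).Nonempty
  · obtain ⟨k₀, hk₀⟩ := h3
    rw [Finset.mem_filter] at hk₀
    have ebr : (I.filter fun i => (c ≤ n - i ∧ ¬ ap ≤ i ∧ ¬ d ≤ n - i ∧ bp ≤ i) ∨ (¬ c ≤ n - i ∧ ap ≤ i ∧ d ≤ n - i ∧ ¬ bp ≤ i)) =
        I.filter fun i => c ≤ n - i ∧ ¬ ap ≤ i ∧ ¬ d ≤ n - i ∧ bp ≤ i := by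
      refine Finset.filter_congr fun i _ => ⟨fun h => h.elim id fun h => by omega, Or.inl⟩
    rw [ebr]
    -- type 1′ alone: mirror of `cross_le` with (U, W) exchanged: br1′ ⊆ [bp, n − c], paid by len[b, n−c] (plain) and len[bp, n−cp] (lifted)
    have hsub : (I.filter fun i => c ≤ n - i ∧ ¬ ap ≤ i ∧ ¬ d ≤ n - i ∧ bp ≤ i) ⊆ Finset.Icc bp (n - c) := by
      intro i hi
      rw [Finset.mem_filter] at hi
      rw [Finset.mem_Icc]
      omega
    have c1 := Finset.card_le_card hsub
    rw [Nat.card_Icc] at c1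
    have g2 := BCount.len_le_good' (n := n) (a := ap) (d := dp) hbp1 hcp1
    omega
  · have ebr : (I.filter fun i => (c ≤ n - i ∧ ¬ ap ≤ i ∧ ¬ d ≤ n - i ∧ bp ≤ i) ∨ (¬ c ≤ n - i ∧ ap ≤ i ∧ d ≤ n - i ∧ ¬ bp ≤ i)) =
        I.filter fun i => ¬ c ≤ n - i ∧ ap ≤ i ∧ d ≤ n - i ∧ ¬ bp ≤ i := by
      refine Finset.filter_congr fun i hiI => ⟨fun h => h.elim (fun h => ?_) id, Or.inr⟩
      exact absurd ⟨i, Finset.mem_filter.2 ⟨hiI, h⟩⟩ h3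
    rw [ebr]
    have hsub : (I.filter fun i => ¬ c ≤ n - i ∧ ap ≤ i ∧ d ≤ n - i ∧ ¬ bp ≤ i) ⊆ Finset.Icc ap (n - d) := by
      intro i hi
      rw [Finset.mem_filter] at hi
      rw [Finset.mem_Icc]
      omega
    have c1 := Finset.card_le_card hsub
    rw [Nat.card_Icc] at c1
    have g2 := BCount.len_le_good (n := n) (c := cp) (b := bp) hap1 hdp1
    omega

end OSCount

end Antithetic

end Summit.CriticalPhenomena.PercolationContinuityZ3.Theorems
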